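import Mathlib
import HarnessLib
import Summits.NavierStokesRegularity.NavierStokesRegularity.Theorems.WakeRatchetMinimalViscousBlowupViscosityBootstrap
import Summits.NavierStokesRegularity.NavierStokesRegularity.Theorems.WakeRatchetMinimalViscousBlowupRegularOpen

/-!
# Route `WakeRatchet`, crux `MinimalViscousBlowup` (stmt-NavierStokesRegularity-22743) — LINE g11-1 «threshold ray» (ns-idea-1 g11):
# UNIQUENESS of global regular viscous lattice solutions (corollary of (E2) `weighted_continuity` at equal viscosities)

* `viscousGlobal_unique` — two `ViscousGlobal ε₀ ν α X₀` solutions of an `InTableClass R` table coincide on `[0, ∞)`: apply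
  `weighted_continuity` (p704548) to the pair with `ν' = ν` (the smallness hypothesis is `C·M·|ν−ν| = 0 ≤ η`) for every `η ∈ (0,1]`.
Used by STUB-PLAN-ceilingOffThreshold (S3b-α1: «uniformity over all globals at a fixed viscosity» is no extra input) and by the threshold
continuity arguments.  MODEL lattice ODEs only; nothing here concerns the Navier–Stokes equations.
`--supports stmt-NavierStokesRegularity-22743 --as helper`.
[cite: Teschl2012, Thm. 2.8; Tao2016AveragedNS, §4 Lemma 4.1 (4.5)]
-/

noncomputable section

-- the summit and its single sub-problem share the name (CONVENTIONS §1)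
set_option linter.dupNamespace false

open Set Filter Topology

namespace Summit.NavierStokesRegularity.NavierStokesRegularity.Theorems.MinimalViscousBlowup.ThresholdRay

open Literature.Analysis.FluidPDE Literature.Analysis.FluidPDE.TaoCascade

/-- **Uniqueness of global regular viscous solutions** from the one-shell datum: if `X` and `Y` are both
`ViscousGlobal ε₀ ν α X₀` for a table in `InTableClass R`, then `X i k t = Y i k t` for all `t ≥ 0`.
[cite: Teschl2012, Thm. 2.8 (uniqueness / dependence on parameters); Tao2016AveragedNS, §4 Lemma 4.1 (4.5)] -/
theorem viscousGlobal_unique {ε₀ ν R : ℝ} (hε : 0 < ε₀) (hν : 0 ≤ ν)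
    {α : Fin 4 → Fin 4 → Fin 4 → ℤ × ℤ × ℤ → ℝ} (hα : InTableClass R α) {X₀ : Fin 4 → ℝ}
    {X Y : Fin 4 → ℤ → ℝ → ℝ} (hX : ViscousGlobal ε₀ ν α X₀ X) (hY : ViscousGlobal ε₀ ν α X₀ Y) :
    ∀ (i : Fin 4) (k : ℤ) (t : ℝ), 0 ≤ t → X i k t = Y i k t := by
  intro i k t ht
  -- the restricted table is bounded by `1` and drives the same nonlinearity
  have hα' : ∀ i₁ i₂ i₃ μ, |restrictShiftSet α i₁ i₂ i₃ μ| ≤ 1 :=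
    abs_restrictShiftSet_le zero_le_one (abs_le_one_of_inTableClass hα)
  -- a priori bounds of both solutions on `[0, t+1]`
  obtain ⟨M₀, hM₀⟩ := hX.apriori (t + 1) (by linarith)
  set M : ℝ := max M₀ 0 with hMdef
  have hM0 : 0 ≤ M := le_max_right _ _
  have hM : ∀ τ ∈ Icc (0 : ℝ) (t + 1), ∀ (j : Fin 4) (n : ℤ), (1 + (1 + ε₀) ^ ((10 : ℝ) * n)) * |X j n τ| ≤ M :=
    fun τ hτ j n => (hM₀ τ hτ j n).trans (le_max_left _ _)
  obtain ⟨M', hM'⟩ := hY.apriori (t + 1) (by linarith)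
  -- derivatives within `Icc 0 (t+1)` with the restricted table
  have hder : ∀ {Z : Fin 4 → ℤ → ℝ → ℝ}, ViscousGlobal ε₀ ν α X₀ Z → ∀ (j : Fin 4) (n : ℤ), ∀ τ ∈ Icc (0 : ℝ) (t + 1),
      HasDerivWithinAt (Z j n)
        (quadTerm ε₀ (restrictShiftSet α) Z j n τ - ν * (1 + ε₀) ^ ((2 : ℝ) * n) * Z j n τ) (Icc 0 (t + 1)) τ := by
    intro Z hZ j n τ hτ
    have h := ((hZ.contDiffOn j n).differentiableOn one_ne_zero τ (mem_Ici.2 hτ.1)).hasDerivWithinAt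
    rw [hZ.motion j n τ hτ.1, ← quadTerm_restrictShiftSet] at h
    exact h.mono fun u hu => hu.1
  -- closeness to every `η ∈ (0,1]`
  have hclose : ∀ η : ℝ, 0 < η → η ≤ 1 → |Y i k t - X i k t| ≤ η := by
    intro η hη hη1
    have hwc := weighted_continuity (m := 4) (S := t + 1) (s := t + 1) (ν' := ν) hε zero_le_one hα' hν hM0 hη hη1
      le_rfl (X := X) (Y := Y)
      (fun j n => by rw [hX.init, hY.init])
      (fun j n hn τ hτ => hX.noLow j n τ hn hτ.1) (fun j n hn τ hτ => hY.noLow j n τ hn hτ.1)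
      hM ⟨M', hM'⟩ (hder hX) (hder hY) (by rw [sub_self, abs_zero, mul_zero]; exact hη.le)
      t ⟨ht, by linarith⟩ i k
    -- drop the weight `(1+ε₀)^{8k⁺} ≥ 1`
    have hk0 : (0 : ℝ) ≤ ((max k 0 : ℤ) : ℝ) := by exact_mod_cast le_max_right k 0
    have hw1 : (1 : ℝ) ≤ (1 + ε₀) ^ ((8 : ℝ) * ((max k 0 : ℤ) : ℝ)) :=
      Real.one_le_rpow (by linarith) (by positivity)
    have habs : 0 ≤ |Y i k t - X i k t| := abs_nonneg _
    calc |Y i k t - X i k t| = 1 * |Y i k t - X i k t| := (one_mul _).symm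
      _ ≤ (1 + ε₀) ^ ((8 : ℝ) * ((max k 0 : ℤ) : ℝ)) * |Y i k t - X i k t| :=
          mul_le_mul_of_nonneg_right hw1 habs
      _ ≤ η := hwc
  refine eq_of_forall_dist_le fun η hη => ?_
  rw [Real.dist_eq, abs_sub_comm]
  rcases le_or_gt η 1 with h1 | h1
  · exact hclose η hη h1
  · exact (hclose 1 one_pos le_rfl).trans h1.le

end Summit.NavierStokesRegularity.NavierStokesRegularity.Theorems.MinimalViscousBlowup.ThresholdRay
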